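import Summits.CriticalPhenomena.SAWScalingLimit.Theorems.SAWDevelopingMapHexConjectureReflexFluxLine
import Summits.CriticalPhenomena.SAWScalingLimit.Theorems.HexConjecture.Negative.NonVacuity
import Literature.Probability.LatticeModels.TriangularLatticeProofs

/-!
# Reflex-wedge geometry, part A: coordinates of the truncated `300°` wedge `W_N`

Support file for the crux `HexConjecture` (stmt-CriticalPhenomena-0808), line
`marginal-reflex-wedge-cauchy-kernel`, stub `stub_reflexWedgeGeometry` (the GEOMETRY of the truncated
reflex wedge `W_N = {v : ‖c_v‖ < N, arg c_v ∉ [0, π/3]}` of the honeycomb lattice, objects file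
`SAWDevelopingMapHexConjectureMarginalWedgeDefs.lean`).

In the cell coordinates `v = ((a, b); t)` of `TriangularLattice.lean` (`t = 0` up-face, `t = 1` down-face;
centre `c_v` with `re c_v = a + b/2 + (t+1)/2`, `im c_v = (b + (t+1)/3) · √3/2`):
* `inSector_center_iff` — the closed `60°` sector `0 ≤ arg ≤ π/3` is EXACTLY the quadrant `0 ≤ a ∧ 0 ≤ b`
  (no honeycomb vertex lies on either ray); `arg_center_neg_iff` (`arg c_v < 0 ↔ b < 0`),
  `pi_div_three_lt_arg_center_iff` (`π/3 < arg c_v ↔ a < 0 ∧ 0 ≤ b`);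
* `norm_center_lt_iff` — `‖c_v‖ < N ↔ Q(v) < 9 N²` with the integer form `Q = qf` of `NonVacuity.lean`;
* `mem_reflexWedge_iff` — membership in `W_N` in coordinates;
* `cornerOut_not_mem`, **`reflexWedge_cornerEdge_mem_boundary`** (the root is a boundary mid-edge of `W_N`;
  `cornerIn ∈ W_N` is `FluxLine.cornerIn_mem` of `SAWDevelopingMapHexConjectureReflexFluxLine.lean`);
* **`reflexWedge_rayZeroDart_eq`**, **`reflexWedge_raySixtyDart_eq`** — CLASSIFICATION of the ray darts:
  a `0°`-ray dart is `((n,-1);1) → ((n,0);0)`, `n ≥ 1`, a `60°`-ray dart is `((-1,n);1) → ((0,n);0)`,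
  `n ≥ 0`; `hexCenter_sub_rayZero`, `hexCenter_sub_raySixty` — their increments `i/√3`, `e^{-iπ/6}/√3`.

All statements are elementary lattice arithmetic (folklore); no named fact is used.
-/

open scoped BigOperators Classical
open Literature.Probability.LatticeModels Literature.Probability.RandomPlanarGeometry
  Literature.Probability.RandomPlanarGeometry.SAW
open Summit.CriticalPhenomena.SAWScalingLimit.Cruxes.HexConjecture.NonVacuity

namespace Summit.CriticalPhenomena.SAWScalingLimit.Theorems.HexConjecture.MarginalWedge.Geometry

/-! ### Centres in coordinates -/

/-- Real part of the centre of the face `((a, b); t)`. [folklore] -/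
theorem re_center (a b : ℤ) (t : Fin 2) :
    (hexCenter (((![a, b] : Site 2), t) : HexVertex)).re =
      (a : ℝ) + (b : ℝ) / 2 + ((((t : ℕ) : ℝ)) + 1) / 2 := by
  rw [hexCenter_re_eq]; simp

/-- Imaginary part of the centre of the face `((a, b); t)`. [folklore] -/
theorem im_center (a b : ℤ) (t : Fin 2) :
    (hexCenter (((![a, b] : Site 2), t) : HexVertex)).im =
      ((b : ℝ) + ((((t : ℕ) : ℝ)) + 1) / 3) * (Real.sqrt 3 / 2) := by
  rw [hexCenter_im_eq]; simp

/-- The type bit of a face is `0` or `1` (as a real number). [folklore] -/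
theorem fin_two_cast (t : Fin 2) : (((t : ℕ) : ℝ)) = 0 ∨ (((t : ℕ) : ℝ)) = 1 := by
  fin_cases t <;> simp

/-- The centre of a face lies strictly above the real axis iff `b ≥ 0`. [folklore] -/
theorem im_center_pos_iff (a b : ℤ) (t : Fin 2) :
    0 < (hexCenter (((![a, b] : Site 2), t) : HexVertex)).im ↔ 0 ≤ b := by
  rw [im_center]
  have hs : 0 < Real.sqrt 3 / 2 := by positivity
  constructor
  · intro h
    have h' : 0 < (b : ℝ) + ((((t : ℕ) : ℝ)) + 1) / 3 := pos_of_mul_pos_left h hs.le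
    have hb : (-1 : ℝ) < b := by rcases fin_two_cast t with ht | ht <;> rw [ht] at h' <;> linarith
    exact_mod_cast (show (-1 : ℤ) < b by exact_mod_cast hb)
  · intro hb
    have hb' : (0 : ℝ) ≤ b := by exact_mod_cast hb
    refine mul_pos ?_ hs
    rcases fin_two_cast t with ht | ht <;> rw [ht] <;> linarith

/-- The centre of a face lies strictly below the real axis iff `b < 0` (no centre is real). [folklore] -/
theorem im_center_neg_iff (a b : ℤ) (t : Fin 2) :
    (hexCenter (((![a, b] : Site 2), t) : HexVertex)).im < 0 ↔ b < 0 := by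
  rw [im_center]
  have hs : 0 < Real.sqrt 3 / 2 := by positivity
  constructor
  · intro h
    by_contra hb
    push Not at hb
    have := (im_center_pos_iff a b t).2 hb
    rw [im_center] at this
    linarith
  · intro hb
    have hb' : (b : ℝ) ≤ -1 := by exact_mod_cast (show b ≤ -1 by omega)
    refine mul_neg_of_neg_of_pos ?_ hs
    rcases fin_two_cast t with ht | ht <;> rw [ht] <;> linarith

/-- `arg c_v < 0 ↔ b < 0`. [folklore] -/
theorem arg_center_neg_iff (a b : ℤ) (t : Fin 2) :
    Complex.arg (hexCenter (((![a, b] : Site 2), t) : HexVertex)) < 0 ↔ b < 0 := by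
  rw [Complex.arg_neg_iff, im_center_neg_iff]

/-- **The closed `60°` sector is the quadrant `a ≥ 0, b ≥ 0`** of the cell coordinates: for a face
centre `z` above the axis, `arg z ≤ π/3 ↔ cos (arg z) ≥ 1/2 ↔ 3 re² ≥ im²`, and in coordinates
`2 re z = 2a + b + t + 1`, `im z = (b + (t+1)/3) √3/2`. [folklore] -/
theorem inSector_center_iff (a b : ℤ) (t : Fin 2) :
    InSector (hexCenter (((![a, b] : Site 2), t) : HexVertex)) ↔ 0 ≤ a ∧ 0 ≤ b := by
  set z : ℂ := hexCenter (((![a, b] : Site 2), t) : HexVertex) with hz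
  set τ : ℝ := (((t : ℕ) : ℝ)) with hτ
  have hτ01 : 0 ≤ τ ∧ τ ≤ 1 := by rcases fin_two_cast t with h | h <;> rw [← hτ] at h <;> rw [h] <;> norm_num
  set q : ℝ := (b : ℝ) + (τ + 1) / 3 with hq
  have hre : 2 * z.re = 2 * a + b + τ + 1 := by rw [hz, re_center]; ring
  have him : z.im = q * (Real.sqrt 3 / 2) := by rw [hz, im_center]
  have h3 : Real.sqrt 3 * Real.sqrt 3 = 3 := Real.mul_self_sqrt (by norm_num)
  have hI2 : z.im ^ 2 = q ^ 2 * (3 / 4) := by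
    calc z.im ^ 2 = q ^ 2 * (Real.sqrt 3 * Real.sqrt 3) / 4 := by rw [him]; ring
      _ = q ^ 2 * (3 / 4) := by rw [h3]; ring
  have hπ3 : (0 : ℝ) ≤ Real.pi / 3 := by positivity
  unfold InSector
  constructor
  · rintro ⟨h0, h1⟩
    have him0 : 0 ≤ z.im := Complex.arg_nonneg_iff.1 h0
    have hb : 0 ≤ b := by
      by_contra hb
      push Not at hb
      have := (im_center_neg_iff a b t).2 hb
      linarith
    have hb' : (0 : ℝ) ≤ b := by exact_mod_cast hb
    have hq0 : 0 ≤ q := by rw [hq]; linarith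
    have himp : 0 < z.im := (im_center_pos_iff a b t).2 hb
    have hzne : z ≠ 0 := fun h => by rw [h] at himp; simp at himp
    have hcos : Real.cos (Real.pi / 3) ≤ Real.cos (Complex.arg z) :=
      Real.cos_le_cos_of_nonneg_of_le_pi h0 (by linarith [Real.pi_pos]) h1
    rw [Real.cos_pi_div_three, Complex.cos_arg hzne] at hcos
    have hn : 0 < ‖z‖ := norm_pos_iff.2 hzne
    have h2 : ‖z‖ ≤ 2 * z.re := by
      have := (le_div_iff₀ hn).1 hcos
      linarith
    have hre0 : 0 ≤ 2 * z.re := by linarith [norm_nonneg z]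
    have hsq : ‖z‖ ^ 2 ≤ (2 * z.re) ^ 2 := pow_le_pow_left₀ (norm_nonneg _) h2 2
    rw [Complex.sq_norm, Complex.normSq_apply] at hsq
    have hq2 : q ^ 2 ≤ (2 * z.re) ^ 2 := by nlinarith [hsq, hI2]
    have hq3 : q ≤ 2 * z.re := (pow_le_pow_iff_left₀ hq0 hre0 two_ne_zero).1 hq2
    rw [hre, hq] at hq3
    refine ⟨?_, hb⟩
    have ha : (-1 : ℝ) < a := by linarith
    exact_mod_cast (show (-1 : ℤ) < a by exact_mod_cast ha)
  · rintro ⟨ha, hb⟩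
    have himp : 0 < z.im := (im_center_pos_iff a b t).2 hb
    have hzne : z ≠ 0 := fun h => by rw [h] at himp; simp at himp
    refine ⟨Complex.arg_nonneg_iff.2 himp.le, ?_⟩
    by_contra h1
    push Not at h1
    have hcos : Real.cos (Complex.arg z) < Real.cos (Real.pi / 3) :=
      Real.cos_lt_cos_of_nonneg_of_le_pi hπ3 (Complex.arg_le_pi z) h1
    rw [Real.cos_pi_div_three, Complex.cos_arg hzne] at hcos
    have hn : 0 < ‖z‖ := norm_pos_iff.2 hzne
    have h2 : 2 * z.re < ‖z‖ := by
      have := (div_lt_iff₀ hn).1 hcos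
      linarith
    have ha' : (0 : ℝ) ≤ a := by exact_mod_cast ha
    have hb' : (0 : ℝ) ≤ b := by exact_mod_cast hb
    have hq0 : 0 ≤ q := by rw [hq]; linarith
    have hre0 : 0 ≤ 2 * z.re := by rw [hre]; linarith
    have hsq : (2 * z.re) ^ 2 < ‖z‖ ^ 2 := pow_lt_pow_left₀ h2 hre0 two_ne_zero
    rw [Complex.sq_norm, Complex.normSq_apply] at hsq
    have hq2 : (2 * z.re) ^ 2 < q ^ 2 := by nlinarith [hsq, hI2]
    have hq3 : 2 * z.re < q := (pow_lt_pow_iff_left₀ hre0 hq0 two_ne_zero).1 hq2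
    rw [hre, hq] at hq3
    linarith

/-- `π/3 < arg c_v ↔ a < 0 ∧ 0 ≤ b` (beyond the `60°` ray). [folklore] -/
theorem pi_div_three_lt_arg_center_iff (a b : ℤ) (t : Fin 2) :
    Real.pi / 3 < Complex.arg (hexCenter (((![a, b] : Site 2), t) : HexVertex)) ↔ a < 0 ∧ 0 ≤ b := by
  have hS := inSector_center_iff a b t
  unfold InSector at hS
  constructor
  · intro h
    have h0 : 0 ≤ Complex.arg (hexCenter (((![a, b] : Site 2), t) : HexVertex)) := by
      linarith [Real.pi_pos]
    have hb : 0 ≤ b := by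
      by_contra hb
      push Not at hb
      have := (arg_center_neg_iff a b t).2 hb
      linarith
    refine ⟨?_, hb⟩
    by_contra ha
    push Not at ha
    have := (hS.2 ⟨ha, hb⟩).2
    linarith
  · rintro ⟨ha, hb⟩
    have h0 : 0 ≤ Complex.arg (hexCenter (((![a, b] : Site 2), t) : HexVertex)) :=
      Complex.arg_nonneg_iff.2 ((im_center_pos_iff a b t).2 hb).le
    by_contra h
    push Not at h
    have := (hS.1 ⟨h0, h⟩).1
    omega

/-! ### Norms and membership in `W_N` -/

/-- `Q` of an up-face in coordinates. [folklore] -/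
theorem qf_mk_zero (a b : ℤ) :
    qf (((![a, b] : Site 2), (0 : Fin 2)) : HexVertex) =
      (3 * a + 1) ^ 2 + (3 * a + 1) * (3 * b + 1) + (3 * b + 1) ^ 2 := by
  simp [qf, qA, qB]

/-- `Q` of a down-face in coordinates. [folklore] -/
theorem qf_mk_one (a b : ℤ) :
    qf (((![a, b] : Site 2), (1 : Fin 2)) : HexVertex) =
      (3 * a + 2) ^ 2 + (3 * a + 2) * (3 * b + 2) + (3 * b + 2) ^ 2 := by
  simp [qf, qA, qB]; ring

/-- `‖c_v‖ < N ↔ Q(v) < 9 N²` (`9 ‖c_v‖² = Q(v)`). [folklore] -/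
theorem norm_center_lt_iff (v : HexVertex) {N : ℝ} (hN : 0 ≤ N) :
    ‖hexCenter v‖ < N ↔ (qf v : ℝ) < 9 * N ^ 2 := by
  rw [← nine_mul_norm_sq, ← pow_lt_pow_iff_left₀ (norm_nonneg _) hN two_ne_zero]
  constructor <;> intro h <;> linarith

/-- `N ≤ ‖c_v‖ ↔ 9 N² ≤ Q(v)`. [folklore] -/
theorem le_norm_center_iff (v : HexVertex) {N : ℝ} (hN : 0 ≤ N) :
    N ≤ ‖hexCenter v‖ ↔ 9 * N ^ 2 ≤ (qf v : ℝ) := by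
  rw [← not_lt, norm_center_lt_iff v hN, not_lt]

/-- **Membership in `W_N` in coordinates**: `Q < 9N²` and not in the quadrant `a, b ≥ 0`. [folklore] -/
theorem mem_reflexWedge_iff {Λ : Finset HexVertex} {N : ℝ} (hN : 0 ≤ N) (hW : IsReflexWedgeTruncation Λ N)
    (a b : ℤ) (t : Fin 2) :
    (((![a, b] : Site 2), t) : HexVertex) ∈ Λ ↔
      (qf (((![a, b] : Site 2), t) : HexVertex) : ℝ) < 9 * N ^ 2 ∧ ¬ (0 ≤ a ∧ 0 ≤ b) := by
  rw [hW, norm_center_lt_iff _ hN, inSector_center_iff]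

/-- Off `W_N` in coordinates: `9N² ≤ Q` or in the quadrant. [folklore] -/
theorem not_mem_reflexWedge_iff {Λ : Finset HexVertex} {N : ℝ} (hN : 0 ≤ N)
    (hW : IsReflexWedgeTruncation Λ N) (a b : ℤ) (t : Fin 2) :
    (((![a, b] : Site 2), t) : HexVertex) ∉ Λ ↔
      9 * N ^ 2 ≤ (qf (((![a, b] : Site 2), t) : HexVertex) : ℝ) ∨ (0 ≤ a ∧ 0 ≤ b) := by
  rw [mem_reflexWedge_iff hN hW, not_and_or, not_lt, not_not]

/-! ### The root edge -/

/-- `cornerOut ∉ W_N` (it lies in the closed sector). [folklore] -/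
theorem cornerOut_not_mem {Λ : Finset HexVertex} {N : ℝ} (hN : 1 ≤ N) (hW : IsReflexWedgeTruncation Λ N) :
    cornerOut ∉ Λ := by
  rw [cornerOut, not_mem_reflexWedge_iff (by linarith) hW]
  exact Or.inr ⟨le_rfl, le_rfl⟩

/-- The westward move: up-face of the cell `x` to the down-face of `x - e₀`. [folklore] -/
theorem hexGraph_adj_west (a b : ℤ) :
    hexGraph.Adj (((![a, b] : Site 2), (0 : Fin 2)) : HexVertex) ((![a - 1, b] : Site 2), (1 : Fin 2)) := by
  have h := (hexGraph_adj_e0 (a - 1) b).symm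
  rwa [sub_add_cancel] at h

/-- The root edge is an edge of `ℍ`. [folklore] -/
theorem adj_cornerIn_cornerOut : hexGraph.Adj cornerIn cornerOut := by
  have h := hexGraph_adj_e1 0 (-1)
  norm_num at h
  exact h

/-- **The root `cornerEdge` is a boundary mid-edge of `W_N`**, `N ≥ 1`. [folklore] -/
theorem reflexWedge_cornerEdge_mem_boundary : ∀ (Λ : Finset HexVertex) (N : ℝ), 1 ≤ N → IsReflexWedgeTruncation Λ N → cornerEdge ∈ hexDomainBoundary Λ :=
  fun _ _ hN hW => ⟨(SimpleGraph.mem_edgeSet hexGraph).2 adj_cornerIn_cornerOut, cornerOut, cornerIn, Sym2.eq_swap,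
    FluxLine.cornerIn_mem hN hW, cornerOut_not_mem hN hW⟩

/-! ### Classification of the ray darts -/

/-- **The `0°`-ray darts of `W_N`** are the vertical edges `((n,-1);1) → ((n,0);0)`, `n ≥ 1`: the inner
vertex is below the axis, the outer one in the quadrant, and of the three honeycomb moves only the
vertical one crosses the axis. [folklore] -/
theorem reflexWedge_rayZeroDart_eq : ∀ (Λ : Finset HexVertex) (N : ℝ), 1 ≤ N → IsReflexWedgeTruncation Λ N → ∀ v w : HexVertex, v ∈ Λ → w ∉ Λ → hexGraph.Adj v w → IsRayZeroDart N v w → ∃ n : ℕ, 1 ≤ n ∧ v = ((![(n : ℤ), -1] : Site 2), (1 : Fin 2)) ∧ w = ((![(n : ℤ), 0] : Site 2), (0 : Fin 2)) := by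
  rintro Λ N hN hW ⟨x, t⟩ ⟨y, t'⟩ - hw hadj ⟨hwN, hvarg, hne⟩
  obtain ⟨a, b, rfl⟩ : ∃ a b : ℤ, x = ![a, b] := ⟨x 0, x 1, by funext j; fin_cases j <;> rfl⟩
  obtain ⟨a', b', rfl⟩ : ∃ a' b' : ℤ, y = ![a', b'] := ⟨y 0, y 1, by funext j; fin_cases j <;> rfl⟩
  rw [arg_center_neg_iff] at hvarg
  rw [not_mem_reflexWedge_iff (by linarith) hW, ← not_lt, ← norm_center_lt_iff _ (by linarith)] at hw
  have hw' : 0 ≤ a' ∧ 0 ≤ b' := by tauto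
  rw [hexGraph_adj_iff_coord] at hadj
  simp only [Matrix.cons_val_zero, Matrix.cons_val_one] at hadj
  have key : t = 1 ∧ t' = 0 ∧ b = -1 ∧ b' = 0 ∧ a = a' ∧ 0 ≤ a := by
    rcases hadj with ⟨ht, ht', h⟩ | ⟨ht, ht', h⟩ <;> refine ?_ <;> omega
  obtain ⟨rfl, rfl, rfl, rfl, rfl, ha⟩ := key
  have ha0 : a ≠ 0 := by
    rintro rfl
    exact hne rfl
  refine ⟨a.toNat, by omega, ?_, ?_⟩ <;> rw [Int.toNat_of_nonneg ha]

/-- **The `60°`-ray darts of `W_N`** are the edges `((-1,n);1) → ((0,n);0)`, `n ≥ 0` (direction `-30°`).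
[folklore] -/
theorem reflexWedge_raySixtyDart_eq : ∀ (Λ : Finset HexVertex) (N : ℝ), 1 ≤ N → IsReflexWedgeTruncation Λ N → ∀ v w : HexVertex, v ∈ Λ → w ∉ Λ → hexGraph.Adj v w → IsRaySixtyDart N v w → ∃ n : ℕ, v = ((![-1, (n : ℤ)] : Site 2), (1 : Fin 2)) ∧ w = ((![0, (n : ℤ)] : Site 2), (0 : Fin 2)) := by
  rintro Λ N hN hW ⟨x, t⟩ ⟨y, t'⟩ - hw hadj ⟨hwN, hvarg⟩
  obtain ⟨a, b, rfl⟩ : ∃ a b : ℤ, x = ![a, b] := ⟨x 0, x 1, by funext j; fin_cases j <;> rfl⟩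
  obtain ⟨a', b', rfl⟩ : ∃ a' b' : ℤ, y = ![a', b'] := ⟨y 0, y 1, by funext j; fin_cases j <;> rfl⟩
  rw [pi_div_three_lt_arg_center_iff] at hvarg
  rw [not_mem_reflexWedge_iff (by linarith) hW, ← not_lt, ← norm_center_lt_iff _ (by linarith)] at hw
  have hw' : 0 ≤ a' ∧ 0 ≤ b' := by tauto
  rw [hexGraph_adj_iff_coord] at hadj
  simp only [Matrix.cons_val_zero, Matrix.cons_val_one] at hadj
  have key : t = 1 ∧ t' = 0 ∧ a = -1 ∧ a' = 0 ∧ b = b' ∧ 0 ≤ b := by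
    rcases hadj with ⟨ht, ht', h⟩ | ⟨ht, ht', h⟩ <;> refine ?_ <;> omega
  obtain ⟨rfl, rfl, rfl, rfl, rfl, hb⟩ := key
  refine ⟨b.toNat, ?_, ?_⟩ <;> rw [Int.toNat_of_nonneg hb]

/-- `1/√3 = √3/3`. [folklore] -/
theorem inv_sqrt_three : (Real.sqrt 3)⁻¹ = Real.sqrt 3 / 3 := by
  have h3 : Real.sqrt 3 * Real.sqrt 3 = 3 := Real.mul_self_sqrt (by norm_num)
  have hs : Real.sqrt 3 ≠ 0 := by positivity
  field_simp
  linarith [h3]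

/-- The increment of a `0°`-ray dart is `i/√3` (a vertical edge). [folklore] -/
theorem hexCenter_sub_rayZero (n : ℤ) :
    hexCenter (((![n, 0] : Site 2), (0 : Fin 2)) : HexVertex) -
        hexCenter (((![n, -1] : Site 2), (1 : Fin 2)) : HexVertex) =
      ((Real.sqrt 3)⁻¹ : ℝ) * Complex.I := by
  apply Complex.ext
  · rw [Complex.sub_re, re_center, re_center]
    simp
    ring
  · rw [Complex.sub_im, im_center, im_center, inv_sqrt_three]
    simp
    ring

/-- `e^{-iπ/6} = √3/2 - i/2`. [folklore] -/
theorem exp_neg_pi_div_six_mul_I :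
    Complex.exp (-(Real.pi / 6) * Complex.I) = ((Real.sqrt 3 / 2 : ℝ) : ℂ) + ((-(1 / 2) : ℝ) : ℂ) * Complex.I := by
  have hcos : Real.cos (-(Real.pi / 6)) = Real.sqrt 3 / 2 := by rw [Real.cos_neg, Real.cos_pi_div_six]
  have hsin : Real.sin (-(Real.pi / 6)) = -(1 / 2) := by rw [Real.sin_neg, Real.sin_pi_div_six]
  have harg : (-(Real.pi / 6) * Complex.I : ℂ) = ((-(Real.pi / 6) : ℝ) : ℂ) * Complex.I := by
    push_cast; ring
  rw [harg, Complex.exp_mul_I, ← Complex.ofReal_cos, ← Complex.ofReal_sin, hcos, hsin]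

/-- The increment of a `60°`-ray dart is `e^{-iπ/6}/√3`. [folklore] -/
theorem hexCenter_sub_raySixty (n : ℤ) :
    hexCenter (((![0, n] : Site 2), (0 : Fin 2)) : HexVertex) -
        hexCenter (((![-1, n] : Site 2), (1 : Fin 2)) : HexVertex) =
      ((Real.sqrt 3)⁻¹ : ℝ) * Complex.exp (-(Real.pi / 6) * Complex.I) := by
  have h3 : Real.sqrt 3 ^ 2 = 3 := Real.sq_sqrt (by norm_num)
  rw [exp_neg_pi_div_six_mul_I]
  apply Complex.ext
  · rw [Complex.sub_re, re_center, re_center]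
    simp [inv_sqrt_three]
    linarith [h3]
  · rw [Complex.sub_im, im_center, im_center]
    simp [inv_sqrt_three]
    ring

end Summit.CriticalPhenomena.SAWScalingLimit.Theorems.HexConjecture.MarginalWedge.Geometry
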